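import Mathlib
import Summits.CriticalPhenomena.CardyFormulaZ2.Theorems.CardyMagicRigidityDefs
import Summits.CriticalPhenomena.CardyFormulaZ2.Theorems.CardyMagicRigidityMagicFormulaTStubCellBridge
import Literature.Probability.Percolation.FKLoopWindingCells
import Literature.Probability.Percolation.InterfaceLoopDeterminism
import Literature.Probability.Percolation.MedialPolygon
import HarnessLib

/-!
# Crux `NestingRigidity`, line `ring-cloud-tomography` (r5): the medial-cell bridge on bond-`ℤ²`
# (keystone K3 `smearedCentring_zEns`, part 1/3)

Crux `Summit.CriticalPhenomena.CardyFormulaZ2.Theses.CardyMagicRigidity.NestingRigidity`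
(stmt-CriticalPhenomena-4835), line `ring-cloud-tomography`, keystone helper K3
`smearedCentring_zEns` (the exact untilted first-moment identity `E_{1/2}[Σ_u ∫_{W(u,·) ≠ 0} f] = 0`
on bond-`ℤ²` at every mesh, the `ℤ²` twin of `MagicFormulaT.LineSketch.smearedCentring`).  This file
is the CELL BRIDGE, the `ℤ²` analogue of `…MagicFormulaTStubCellBridge` / `…MagicFormulaTHexCells`,
at mesh `δ` directly (no dilation step): the open cells of the medial lattice of `δℤ²` are the scaled
open diamonds `scaledCell δ F = δ · cellInterior F`, `F ∈ ℤ × ℤ` (`FKLoopWindingCells`: the diamonds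
about the vertices `δℤ²` and about the plaquette centres `δ(ℤ + ½)²`, in the medial coordinates
`(x + y − ½, y − x + ½)`), with centres `δ · cellCenter F`.

* §1 the trace of every interface loop lies on the medial lines (`range_loopCurve_one_subset_medialLines`,
  dart by dart: `segment_cSrc_cTgt_subset_medialLines`), so its winding number is constant on every
  open cell (convex, off the lines), at mesh `1` and at mesh `δ` (`wind_eq_wind_center_of_mem_scaledCell`);
* §2 the scaled cells are measurable, pairwise disjoint and cover `ℂ` up to the null scaled medial
  lines (`ae_exists_mem_scaledCell`); a cell meeting `B̄(0, R)` has its index in the box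
  `[-N, N]²`, `N ≥ 2R/δ + 2` (`mem_cellBox_of_mem_scaledCell`);
* §3 for an admissible density `f` (measurable, `|f| ≤ C`, `f = 0` off `‖z‖ ≤ R`): loop by loop,
  `∫_{W(u,·) ≠ 0} f = Σ_{F ∈ [-N,N]²} 𝟙[W(u, δ c_F) ≠ 0] · ∫_{δ·cell F} f` (registered anchor
  `nestingPhase_eq_sum_cells_zEns`), and the cell charges are neutral when `∫ f = 0`
  (`sum_cellCharge_eq_zero`).

No definition, no cited fact; the abstract cell decomposition `setIntegral_setOf_ne_zero_eq_sum` of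
`…MagicFormulaTStubCellBridge` is reused.
-/

noncomputable section

open MeasureTheory Set Filter Metric
open scoped Real Topology BigOperators

namespace Summit.CriticalPhenomena.CardyFormulaZ2.Cruxes.NestingRigidity.RingCloudTomography

open Literature.Probability.RandomPlanarGeometry Literature.Probability.Percolation
  Literature.Probability.LatticeModels
open Summit.CriticalPhenomena.CardyFormulaZ2.Cruxes.MagicFormulaT.LineSketch
  (setIntegral_setOf_ne_zero_eq_sum integral_eq_sum_setIntegral)

namespace SmearedCentringZ2

/-! ## §1 Winding numbers of interface loops are constant on the open medial cells -/

section Loops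

variable {ω : BondConfig (Site 2)} {γ : List MedialVertex}

/-- **The trace of every interface loop (mesh `1`) lies on the medial lines**: each dart segment is
the corner cut of a coded corner. -/
theorem range_loopCurve_one_subset_medialLines (h : IsInterfaceLoop ω γ) :
    (loopCurve 1 0 γ).range ⊆ medialLines := by
  rw [range_loopCurve_zero 1 h.ne_nil]
  refine Set.iUnion₂_subset fun q hq ↦ ?_
  obtain ⟨e, e'⟩ := q
  obtain ⟨p, hps, hpt⟩ := isMedialDart_iff_exists_corner.1 (h.isMedialDart_of_mem_zip hq)
  rw [← hps, ← hpt]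
  exact segment_cSrc_cTgt_subset_medialLines p

/-- **At mesh `1` the winding number of an interface loop is constant on every open cell**, equal to
its value at the cell centre (the cell is convex and misses the trace). -/
theorem wind_loopCurve_one_eq_of_mem_cellInterior (h : IsInterfaceLoop ω γ) (F : ℤ × ℤ) {z : ℂ}
    (hz : z ∈ cellInterior F) :
    (loopCurve 1 0 γ).wind z = (loopCurve 1 0 γ).wind (cellCenter F) :=
  CurveClass.wind_eq_of_segment_disjoint _ (isLoop_loopCurve 1 0 h.ne_nil)
    (Set.disjoint_of_subset
      ((convex_cellInterior F).segment_subset hz (cellCenter_mem_cellInterior F))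
      (range_loopCurve_one_subset_medialLines h) (cellInterior_disjoint_medialLines F))

/-- **At mesh `δ ≠ 0` the winding number of an interface loop is constant on every scaled cell**
`δ · cell F`, equal to its value at the scaled centre `δ · c_F`. -/
theorem wind_loopCurve_eq_of_mem_scaledCell {δ : ℝ} (hδ : δ ≠ 0) (h : IsInterfaceLoop ω γ)
    (F : ℤ × ℤ) {z : ℂ} (hz : z ∈ scaledCell δ F) :
    (loopCurve δ 0 γ).wind z = (loopCurve δ 0 γ).wind ((δ : ℂ) * cellCenter F) := by
  rw [wind_loopCurve_mesh hδ, wind_loopCurve_mesh hδ,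
    mul_div_cancel_left₀ _ (Complex.ofReal_ne_zero.2 hδ)]
  exact wind_loopCurve_one_eq_of_mem_cellInterior h F hz

end Loops

/-- **The winding number of every loop of `zEns.X δ ω = bondLoopConfig δ 0 ω` (`δ ≠ 0`) is constant
on every scaled cell**, equal to its value at the scaled centre. -/
theorem wind_eq_wind_center_of_mem_scaledCell {δ : ℝ} (hδ : δ ≠ 0) {ω : BondConfig (Site 2)}
    {u : UnbasedLoop ℂ} (hu : u ∈ (bondLoopConfig δ 0 ω).loops) (F : ℤ × ℤ) {z : ℂ}
    (hz : z ∈ scaledCell δ F) : u.wind z = u.wind ((δ : ℂ) * cellCenter F) := by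
  rcases hu with ⟨γ, hγ, -, rfl⟩ | ⟨γ, hγ, -, rfl⟩ <;>
    exact wind_loopCurve_eq_of_mem_scaledCell hδ hγ F hz

/-! ## §2 The scaled cells tile the plane; the charge box -/

/-- Distinct scaled cells are disjoint. -/
theorem disjoint_scaledCell (δ : ℝ) {F F' : ℤ × ℤ} (h : F ≠ F') :
    Disjoint (scaledCell δ F) (scaledCell δ F') :=
  (cellInterior_disjoint h).preimage _

/-- **The scaled cells cover Lebesgue-almost all of `ℂ`** (`δ ≠ 0`): off the scaled medial lines,
a null set, every point lies in the scaled cell of the integer parts of its medial coordinates. -/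
theorem ae_exists_mem_scaledCell {δ : ℝ} (hδ : δ ≠ 0) :
    ∀ᵐ z ∂(volume : Measure ℂ), ∃ F : ℤ × ℤ, z ∈ scaledCell δ F := by
  have hnull : volume ((fun z : ℂ ↦ z / δ) ⁻¹' medialLines) = 0 := by
    have : (fun z : ℂ ↦ z / δ) ⁻¹' medialLines = (fun z : ℂ ↦ (δ⁻¹ : ℝ) • z) ⁻¹' medialLines := by
      ext z; simp [div_eq_inv_mul, Complex.real_smul]
    rw [this, Measure.addHaar_preimage_smul _ (inv_ne_zero hδ), volume_medialLines, mul_zero]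
  rw [ae_iff]
  refine measure_mono_null (fun z hz ↦ ?_) hnull
  by_contra hcon
  exact hz ⟨_, mem_cellInterior_floor hcon⟩

/-- **A scaled cell meeting the closed disc `B̄(0, R)` has its index in the box `[-N, N]²`** for
every `N ≥ 2R/δ + 2` (`δ > 0`; the medial coordinates of `z/δ` are within `1` of the index). -/
theorem mem_cellBox_of_mem_scaledCell {δ R : ℝ} (hδ : 0 < δ) {F : ℤ × ℤ} {z : ℂ}
    (hz : z ∈ scaledCell δ F) (hzR : ‖z‖ ≤ R) {N : ℕ} (hN : 2 * R / δ + 2 ≤ N) :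
    F ∈ Finset.Icc (-(N : ℤ)) N ×ˢ Finset.Icc (-(N : ℤ)) N := by
  obtain ⟨h1, h2, h3, h4⟩ := hz
  simp only [frameX, frameY] at h1 h2 h3 h4
  have hw : ‖z / (δ : ℂ)‖ ≤ R / δ := by
    rw [norm_div, Complex.norm_real, Real.norm_eq_abs, abs_of_pos hδ]
    exact div_le_div_of_nonneg_right hzR hδ.le
  have hre := (abs_le.1 ((Complex.abs_re_le_norm _).trans hw))
  have him := (abs_le.1 ((Complex.abs_im_le_norm _).trans hw))
  have hRδ : 2 * (R / δ) + 2 ≤ N := by rwa [mul_div_assoc] at hN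
  rw [Finset.mem_product, Finset.mem_Icc, Finset.mem_Icc]
  have e1 : ((F.1 : ℤ) : ℝ) < N := by linarith [hre.2, him.2]
  have e2 : (-(N : ℝ)) < F.1 + 1 := by linarith [hre.1, him.1]
  have e3 : ((F.2 : ℤ) : ℝ) < N := by linarith [hre.1, him.2]
  have e4 : (-(N : ℝ)) < F.2 + 1 := by linarith [hre.2, him.1]
  have e1' : F.1 < N := by exact_mod_cast e1
  have e2' : -(N : ℤ) < F.1 + 1 := by exact_mod_cast e2
  have e3' : F.2 < N := by exact_mod_cast e3
  have e4' : -(N : ℤ) < F.2 + 1 := by exact_mod_cast e4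
  exact ⟨⟨by omega, by omega⟩, by omega, by omega⟩

/-! ## §3 The smeared phase of a loop as a combination of cell charges -/

section Density

variable {f : ℂ → ℝ} {R C δ : ℝ}

/-- **An admissible density is integrable** (bounded, measurable, supported in `B̄(0, R)`). -/
theorem integrable_of_admissible (hf : Measurable f) (hC : ∀ z, |f z| ≤ C)
    (hR : ∀ z, R < ‖z‖ → f z = 0) : Integrable f := by
  refine IntegrableOn.integrable_of_forall_notMem_eq_zero (s := closedBall (0 : ℂ) R) ?_
    fun z hz ↦ hR z (by simpa using hz)
  refine Measure.integrableOn_of_bounded (M := C) measure_closedBall_lt_top.ne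
    hf.aestronglyMeasurable (ae_of_all _ fun z ↦ ?_)
  rw [Real.norm_eq_abs]
  exact hC z

/-- **The cells of the charge box carry the density**: a.e., `f` vanishes off
`⋃_{F ∈ [-N,N]²} δ·cell F` whenever `N ≥ 2R/δ + 2`. -/
theorem ae_eq_zero_off_cellBox (hR : ∀ z, R < ‖z‖ → f z = 0) (hδ : 0 < δ) {N : ℕ}
    (hN : 2 * R / δ + 2 ≤ N) :
    ∀ᵐ z ∂(volume : Measure ℂ),
      z ∉ (⋃ F ∈ Finset.Icc (-(N : ℤ)) N ×ˢ Finset.Icc (-(N : ℤ)) N, scaledCell δ F) → f z = 0 := by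
  filter_upwards [ae_exists_mem_scaledCell hδ.ne'] with z hz hzU
  obtain ⟨F, hF⟩ := hz
  by_contra hne
  have hzR : ‖z‖ ≤ R := le_of_not_gt fun h ↦ hne (hR z h)
  exact hzU (Set.mem_iUnion₂.2 ⟨F, mem_cellBox_of_mem_scaledCell hδ hF hzR hN, hF⟩)

/-- **Cell decomposition of the smeared phase of a loop of `zEns`**: for `u ∈ loops(X_δ ω)`,
`∫_{W(u,·) ≠ 0} f = Σ_{F ∈ [-N,N]²} 𝟙[W(u, δ c_F) ≠ 0] ∫_{δ·cell F} f`. -/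
theorem nestingPhase_eq_sum_cells (hf : Measurable f) (hC : ∀ z, |f z| ≤ C)
    (hR : ∀ z, R < ‖z‖ → f z = 0) (hδ : 0 < δ) {N : ℕ} (hN : 2 * R / δ + 2 ≤ N)
    {ω : BondConfig (Site 2)} {u : UnbasedLoop ℂ} (hu : u ∈ (bondLoopConfig δ 0 ω).loops) :
    ∫ z in {z : ℂ | u.wind z ≠ 0}, f z =
      ∑ F ∈ Finset.Icc (-(N : ℤ)) N ×ˢ Finset.Icc (-(N : ℤ)) N,
        if u.wind ((δ : ℂ) * cellCenter F) ≠ 0 then ∫ z in scaledCell δ F, f z else 0 :=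
  setIntegral_setOf_ne_zero_eq_sum _ (fun F _ ↦ measurableSet_scaledCell δ F)
    (fun _ _ _ _ hne ↦ disjoint_scaledCell δ hne) (integrable_of_admissible hf hC hR)
    (ae_eq_zero_off_cellBox hR hδ hN) (UnbasedLoop.isOpen_setOf_wind_ne_zero _).measurableSet
    (fun F ↦ (δ : ℂ) * cellCenter F) fun F _ _ hz ↦ wind_eq_wind_center_of_mem_scaledCell hδ.ne' hu F hz

/-- **The cell charges of a neutral density are neutral**: `Σ_F ∫_{δ·cell F} f = ∫ f = 0`. -/
theorem sum_cellCharge_eq_zero (hf : Measurable f) (hC : ∀ z, |f z| ≤ C)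
    (hR : ∀ z, R < ‖z‖ → f z = 0) (h0 : ∫ z, f z = 0) (hδ : 0 < δ) {N : ℕ}
    (hN : 2 * R / δ + 2 ≤ N) :
    ∑ F ∈ Finset.Icc (-(N : ℤ)) N ×ˢ Finset.Icc (-(N : ℤ)) N, ∫ z in scaledCell δ F, f z = 0 := by
  rw [← integral_eq_sum_setIntegral _ (fun F _ ↦ measurableSet_scaledCell δ F)
    (fun _ _ _ _ hne ↦ disjoint_scaledCell δ hne) (integrable_of_admissible hf hC hR)
    (ae_eq_zero_off_cellBox hR hδ hN)]
  exact h0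

/-- The natural charge box: `N = ⌈2R/δ + 2⌉₊` satisfies `2R/δ + 2 ≤ N`. -/
theorem two_mul_div_add_two_le_ceil (R δ : ℝ) : 2 * R / δ + 2 ≤ (⌈2 * R / δ + 2⌉₊ : ℕ) :=
  Nat.le_ceil _

end Density

end SmearedCentringZ2

open SmearedCentringZ2 in
/-- **The medial-cell bridge on bond-`ℤ²`** (registered helper toward keystone K3
`smearedCentring_zEns`, line `ring-cloud-tomography` r5).  For an admissible density `f`
(measurable, `|f| ≤ C`, `f = 0` off `‖z‖ ≤ R`), a mesh `δ > 0`, a box size `N ≥ 2R/δ + 2`, every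
configuration `ω` and every loop `u` of `bondLoopConfig δ 0 ω`, the smeared phase is the combination
of the cell charges of the scaled medial cells the loop winds around:
`∫_{W(u,·) ≠ 0} f = Σ_{F ∈ [-N,N]²} 𝟙[W(u, δ c_F) ≠ 0] ∫_{δ·cell F} f` — winding numbers of medial
interface loops are constant on the open cells (diamonds about the vertices and about the plaquette
centres), which miss every trace and cover `ℂ` a.e.; and the cell charges are neutral when `∫ f = 0`. -/
theorem nestingPhase_eq_sum_cells_zEns : ∀ (f : ℂ → ℝ) (R C δ : ℝ) (N : ℕ), Measurable f →
    (∀ z, |f z| ≤ C) → (∀ z, R < ‖z‖ → f z = 0) → 0 < δ → 2 * R / δ + 2 ≤ N →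
    (∀ (ω : BondConfig (Site 2)), ∀ u ∈ (bondLoopConfig δ 0 ω).loops,
      ∫ z in {z : ℂ | u.wind z ≠ 0}, f z =
        ∑ F ∈ Finset.Icc (-(N : ℤ)) N ×ˢ Finset.Icc (-(N : ℤ)) N,
          if u.wind ((δ : ℂ) * cellCenter F) ≠ 0 then ∫ z in scaledCell δ F, f z else 0) ∧
    (∫ z, f z = 0 →
      ∑ F ∈ Finset.Icc (-(N : ℤ)) N ×ˢ Finset.Icc (-(N : ℤ)) N, ∫ z in scaledCell δ F, f z = 0) :=
  fun _ _ _ _ _ hf hC hR hδ hN ↦ ⟨fun _ _ hu ↦ nestingPhase_eq_sum_cells hf hC hR hδ hN hu,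
    fun h0 ↦ sum_cellCharge_eq_zero hf hC hR h0 hδ hN⟩

end Summit.CriticalPhenomena.CardyFormulaZ2.Cruxes.NestingRigidity.RingCloudTomography

end
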